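import Mathlib

/-!
# DAG node N12 [B15] — (P4)′ road, step (T1) WITH SUPPORTS: rank-wise (block-triangular) back-substitution over a product of bond spaces `κ → E`, TRACKING THE SUPPORT of
# the preimage through a row-locality map `tower` and a column-support map `col` — a right inverse with a letter AND a closure-type support clause

Cell `pub-ymgap` (HUMAN RULINGS D-0062 ∕ D-0149), width seat `pub-ymgap-dag-n12-w6` g8 (director-ym R463-ym clone by row N12 (P4); the lane owner's census memo
`HOME/pub-ymgap-dag-n12-c/N12-DIRECT-ROW-CENSUS-2026-08-28.md` §7 U2b: «a support clause in (P4)′'s letter (`hHsupp`-type, but now TRUE: support ⊆ towers of supp v)»).  Key K1⁹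
`stmt-QuantumFields-27364`, `--kind proof --supports … --as helper`; count-neutral; THEOREMS ONLY (0 `def`, 0 `sorry`).  Sequel of g6's `…N12DirectSurjTriangular` (p660274), whose
`exists_rightInverse_bound_of_rankwise` hides the construction behind `Classical.choose` and therefore exports nothing about supports.

WHY.  In the (P4)′ assembly the unknown `x : κ → E` is a fine direction on the bonds `κ`, the rows `ι` are the constrained coarse bonds, `(L x) i` depends on `x` only through its
restriction to the SHARP TOWER `tower i ⊆ κ` of the row ([III] (2.10)–(2.11): iterated two-block locality of (0.4)), and the rank-`n` solution exhibited for a target `v` is a sum of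
site columns, supported in `⋃ {col i : rank i = n, v i ≠ 0}`.  Back-substitution then confines the preimage of `v` to `⋃ₙ 𝒮 n` for every RANK-GRADED family `𝒮 : ℕ → Set κ` that is CLOSED in the sense
`∀ i, (v i ≠ 0 ∨ ∃ m < rank i, 𝒮 m ∩ tower i ≠ ∅) → col i ⊆ 𝒮 (rank i)`: the columns fired at rank `n` lie in `𝒮 n` (their rows have `v i ≠ 0`), and the residual target `v − L x₁`
— which VANISHES on the ranks `≤ n` — is again closed for `𝒮` (a row of rank `> n` moved by `x₁` has its tower met by `supp x₁ ⊆ 𝒮 n`, a LOWER grade).  The grading is what keeps the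
clause from propagating sideways: a column of rank `n` sitting in the tower of another rank-`n` row forces nothing, exactly as in the construction, where the rank-`n` solution is EXACT on
all rows of rank `n`.  This is the abstract half of the TRUE support clause of the (P4)′ right inverse; the concrete half
(`…N12DirectSurjHsurjSupport`) instantiates `tower`, `col` at the record's `𝐁_k(Z)` with the rank := the LEVEL of the row.

CONTENTS.  ★ `exists_preimage_bound_support_of_rankwise` (downward induction with the letter `β·m·(1+Λβ)^m` of p660274 AND the closure-support invariant), ★★★
`exists_rightInverse_bound_support_of_rankwise` (the right-inverse FUNCTION with letter `β·N·(1+Λβ)^N` and the graded support clause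
`∀ v 𝒮, (∀ i, (v i ≠ 0 ∨ ∃ m < rank i, ∃ b ∈ 𝒮 m, b ∈ tower i) → col i ⊆ 𝒮 (rank i)) → ∀ b, (∀ m, b ∉ 𝒮 m) → H v b = 0`).

HONEST FRAMING.  Elementary linear algebra (finite back-substitution with bookkeeping of supports), [folklore]; nothing of Bałaban's asserted; N12 NOT discharged; K1⁹ NOT closed;
count-neutral (typed 28∕28 · discharged 6∕28 unmoved by this seat); R4 closes only the conditional finite-𝕋⁴ rung `BalabanLadder.UV`; the YM mass gap (Clay) is NOT proved by any of this.
-/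

namespace Summit.QuantumFields.YangMills.BalabanUVNodes.N12DirectSurjTriangularSupport

variable {κ : Type*} [Fintype κ] {E : Type*} [NormedAddCommGroup E] [NormedSpace ℝ E]
  {ι : Type*} [Fintype ι] {E' : Type*} [NormedAddCommGroup E'] [NormedSpace ℝ E']

/-- ★ **BACK-SUBSTITUTION WITH A LETTER AND WITH SUPPORTS.**  Let `L : (κ → E) → (ι → E')` be linear with `‖L x‖ ≤ Λ‖x‖`, let `rank : ι → ℕ` be bounded by `N`, let `tower i ⊆ κ` carry
the row `i` (`x` vanishing on `tower i` forces `(L x) i = 0`), and suppose that for every rank `n` and every target `v` supported in rank `n` there is `x` with `(L x) i = v i` on rank `n`,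
`(L x) i = 0` below rank `n`, `‖x‖ ≤ β‖v‖`, and `x` supported in `⋃ {col i : rank i = n, v i ≠ 0}`.  Then every target `v` vanishing below rank `n`, `N = n + m`, has a preimage `x` with
`‖x‖ ≤ β·m·(1+Λβ)^m·‖v‖` which vanishes off `⋃ₘ 𝒮 m` for EVERY rank-graded family `𝒮 : ℕ → Set κ` closed in the sense `∀ i, (v i ≠ 0 ∨ ∃ m < rank i, ∃ b ∈ 𝒮 m, b ∈ tower i) →
col i ⊆ 𝒮 (rank i)`. [folklore] -/
theorem exists_preimage_bound_support_of_rankwise (L : (κ → E) →ₗ[ℝ] (ι → E')) (rank : ι → ℕ) {N : ℕ} (hN : ∀ i, rank i < N)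
    (tower col : ι → Set κ) {β Λ : ℝ} (hβ : 0 ≤ β) (hΛ : 0 ≤ Λ)
    (hL : ∀ x, ‖L x‖ ≤ Λ * ‖x‖)
    (hloc : ∀ (x : κ → E) (i : ι), (∀ b ∈ tower i, x b = 0) → L x i = 0)
    (h : ∀ n, ∀ v : ι → E', (∀ i, rank i ≠ n → v i = 0) →
      ∃ x : κ → E, (∀ i, rank i = n → L x i = v i) ∧ (∀ i, rank i < n → L x i = 0) ∧ ‖x‖ ≤ β * ‖v‖ ∧
        (∀ b, x b ≠ 0 → ∃ i, rank i = n ∧ v i ≠ 0 ∧ b ∈ col i)) :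
    ∀ (m n : ℕ), N = n + m → ∀ v : ι → E', (∀ i, rank i < n → v i = 0) →
      ∃ x : κ → E, L x = v ∧ ‖x‖ ≤ β * m * (1 + Λ * β) ^ m * ‖v‖ ∧
        ∀ 𝒮 : ℕ → Set κ, (∀ i, (v i ≠ 0 ∨ ∃ m', m' < rank i ∧ ∃ b ∈ 𝒮 m', b ∈ tower i) → col i ⊆ 𝒮 (rank i)) →
          ∀ b, (∀ m', b ∉ 𝒮 m') → x b = 0 := by
  classical
  -- rank-wise solvability for ARBITRARY targets, through the truncated target (sup norm not larger, support read off the truncation)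
  have h' : ∀ n, ∀ v : ι → E', ∃ x : κ → E, (∀ i, rank i = n → L x i = v i) ∧ (∀ i, rank i < n → L x i = 0) ∧ ‖x‖ ≤ β * ‖v‖ ∧
      (∀ b, x b ≠ 0 → ∃ i, rank i = n ∧ v i ≠ 0 ∧ b ∈ col i) := by
    intro n v
    obtain ⟨x, hx, hx', hxn, hxs⟩ := h n (fun i => if rank i = n then v i else 0) fun i hi => if_neg hi
    refine ⟨x, fun i hi => by rw [hx i hi, if_pos hi], hx', hxn.trans (mul_le_mul_of_nonneg_left ?_ hβ), fun b hb => ?_⟩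
    · refine (pi_norm_le_iff_of_nonneg (norm_nonneg v)).2 fun i => ?_
      by_cases hi : rank i = n
      · rw [if_pos hi]; exact norm_le_pi_norm v i
      · rw [if_neg hi, norm_zero]; exact norm_nonneg v
    · obtain ⟨i, hi, hvi, hbi⟩ := hxs b hb
      rw [if_pos hi] at hvi
      exact ⟨i, hi, hvi, hbi⟩
  intro m
  induction m with
  | zero =>
    intro n hn v hv
    have hv0 : v = 0 := funext fun i => hv i (by rw [← Nat.add_zero n, ← hn]; exact hN i)
    refine ⟨0, ?_, ?_, fun 𝒮 _ b _ => rfl⟩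
    · rw [map_zero, hv0]
    · rw [norm_zero, hv0, norm_zero]; positivity
  | succ m ih =>
    intro n hn v hv
    obtain ⟨x₁, hx₁, hx₁', hx₁n, hx₁s⟩ := h' n v
    have hres : ∀ i, rank i < n + 1 → (v - L x₁) i = 0 := fun i hi => by
      rw [Pi.sub_apply]
      rcases Nat.lt_succ_iff_lt_or_eq.1 hi with hlt | heq
      · rw [hv i hlt, hx₁' i hlt, sub_zero]
      · rw [hx₁ i heq, sub_self]
    obtain ⟨x₂, hx₂, hx₂n, hx₂s⟩ := ih (n + 1) (by rw [hn]; ring) (v - L x₁) hres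
    refine ⟨x₁ + x₂, by rw [map_add, hx₂, add_sub_cancel], ?_, fun 𝒮 h𝒮 b hb => ?_⟩
    · -- the letter (as in p660274)
      have hq : 0 ≤ 1 + Λ * β := by positivity
      have hresn : ‖v - L x₁‖ ≤ (1 + Λ * β) * ‖v‖ := by
        calc ‖v - L x₁‖ ≤ ‖v‖ + ‖L x₁‖ := norm_sub_le _ _
          _ ≤ ‖v‖ + Λ * (β * ‖v‖) := by gcongr; exact (hL x₁).trans (mul_le_mul_of_nonneg_left hx₁n hΛ)
          _ = (1 + Λ * β) * ‖v‖ := by ring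
      have hpow : (1 : ℝ) ≤ (1 + Λ * β) ^ (m + 1) := one_le_pow₀ (by nlinarith)
      calc ‖x₁ + x₂‖ ≤ ‖x₁‖ + ‖x₂‖ := norm_add_le _ _
        _ ≤ β * ‖v‖ + β * m * (1 + Λ * β) ^ m * ((1 + Λ * β) * ‖v‖) :=
            add_le_add hx₁n (hx₂n.trans (mul_le_mul_of_nonneg_left hresn (by positivity)))
        _ = (β * ‖v‖) * 1 + β * m * (1 + Λ * β) ^ (m + 1) * ‖v‖ := by ring
        _ ≤ (β * ‖v‖) * (1 + Λ * β) ^ (m + 1) + β * m * (1 + Λ * β) ^ (m + 1) * ‖v‖ := by gcongr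
        _ = β * ((m + 1 : ℕ) : ℝ) * (1 + Λ * β) ^ (m + 1) * ‖v‖ := by push_cast; ring
    · -- the support: the rank-`n` columns lie in `𝒮 n`, and the residual target (zero on the ranks `≤ n`) is again closed for the graded family `𝒮`
      have h₁ : ∀ b', x₁ b' ≠ 0 → b' ∈ 𝒮 n := fun b' hb' => by
        obtain ⟨i, hi, hvi, hbi⟩ := hx₁s b' hb'
        have h := h𝒮 i (Or.inl hvi) hbi
        rwa [hi] at h
      have h𝒮' : ∀ i, ((v - L x₁) i ≠ 0 ∨ ∃ m', m' < rank i ∧ ∃ b ∈ 𝒮 m', b ∈ tower i) → col i ⊆ 𝒮 (rank i) := by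
        intro i hi
        rcases hi with hne | hmeet
        · by_cases hvi : v i ≠ 0
          · exact h𝒮 i (Or.inl hvi)
          · -- `v i = 0`, so `(L x₁) i ≠ 0`: the row has rank `> n` and `x₁` does not vanish on `tower i`, which therefore meets `𝒮 n`
            have hLi : L x₁ i ≠ 0 := by
              intro h0
              apply hne
              rw [Pi.sub_apply, h0, sub_zero, not_not.1 hvi]
            have hri : n < rank i := by
              by_contra hle
              exact hne (hres i (by omega))
            have hex : ∃ b ∈ tower i, x₁ b ≠ 0 := by
              by_contra hall
              exact hLi (hloc x₁ i fun b hb => not_not.1 fun hne => hall ⟨b, hb, hne⟩)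
            obtain ⟨b', hb't, hb'⟩ := hex
            exact h𝒮 i (Or.inr ⟨n, hri, b', h₁ b' hb', hb't⟩)
        · exact h𝒮 i (Or.inr hmeet)
      have h₂ : x₂ b = 0 := hx₂s 𝒮 h𝒮' b hb
      have h₁b : x₁ b = 0 := by
        by_contra hne
        exact hb n (h₁ b hne)
      rw [Pi.add_apply, h₁b, h₂, add_zero]

/-- ★★★ **RANK-WISE SOLVABILITY WITH A LETTER AND COLUMN SUPPORTS ⟹ A RIGHT INVERSE WITH A LETTER AND A CLOSURE-TYPE SUPPORT CLAUSE** (the support edition of p660274's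
`exists_rightInverse_bound_of_rankwise`, the shape of the (P4)′ support socket): from `‖L x‖ ≤ Λ‖x‖`, row locality through `tower`, and rank-wise solutions of norm `≤ β‖v‖` supported in the
columns `col i` of the rank's rows charged by `v`, a right-inverse FUNCTION `H` with `‖H v‖ ≤ β·N·(1+Λβ)^N·‖v‖` such that `H v` vanishes off `⋃ₘ 𝒮 m` for every rank-graded family `𝒮 : ℕ → Set κ` with
`∀ i, (v i ≠ 0 ∨ ∃ m < rank i, ∃ b ∈ 𝒮 m, b ∈ tower i) → col i ⊆ 𝒮 (rank i)` (towers are read against LOWER grades only: no sideways propagation). [folklore] -/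
theorem exists_rightInverse_bound_support_of_rankwise (L : (κ → E) →ₗ[ℝ] (ι → E')) (rank : ι → ℕ) {N : ℕ} (hN : ∀ i, rank i < N)
    (tower col : ι → Set κ) {β Λ : ℝ} (hβ : 0 ≤ β) (hΛ : 0 ≤ Λ)
    (hL : ∀ x, ‖L x‖ ≤ Λ * ‖x‖)
    (hloc : ∀ (x : κ → E) (i : ι), (∀ b ∈ tower i, x b = 0) → L x i = 0)
    (h : ∀ n, ∀ v : ι → E', (∀ i, rank i ≠ n → v i = 0) →
      ∃ x : κ → E, (∀ i, rank i = n → L x i = v i) ∧ (∀ i, rank i < n → L x i = 0) ∧ ‖x‖ ≤ β * ‖v‖ ∧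
        (∀ b, x b ≠ 0 → ∃ i, rank i = n ∧ v i ≠ 0 ∧ b ∈ col i)) :
    ∃ H : (ι → E') → (κ → E), (∀ v, L (H v) = v) ∧ (∀ v, ‖H v‖ ≤ β * N * (1 + Λ * β) ^ N * ‖v‖) ∧
      ∀ (v : ι → E') (𝒮 : ℕ → Set κ), (∀ i, (v i ≠ 0 ∨ ∃ m, m < rank i ∧ ∃ b ∈ 𝒮 m, b ∈ tower i) → col i ⊆ 𝒮 (rank i)) →
        ∀ b, (∀ m, b ∉ 𝒮 m) → H v b = 0 := by
  classical
  have key := exists_preimage_bound_support_of_rankwise L rank hN tower col hβ hΛ hL hloc h N 0 (by rw [Nat.zero_add])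
  refine ⟨fun v => Classical.choose (key v fun _ hi => (Nat.not_lt_zero _ hi).elim), fun v => ?_, fun v => ?_, fun v => ?_⟩
  · exact (Classical.choose_spec (key v fun _ hi => (Nat.not_lt_zero _ hi).elim)).1
  · exact (Classical.choose_spec (key v fun _ hi => (Nat.not_lt_zero _ hi).elim)).2.1
  · exact (Classical.choose_spec (key v fun _ hi => (Nat.not_lt_zero _ hi).elim)).2.2

end Summit.QuantumFields.YangMills.BalabanUVNodes.N12DirectSurjTriangularSupport
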